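import Summits.BirchSwinnertonDyer.BirchSwinnertonDyer.Theorems.GoldfeldAllTwistsTwoConverseTwinBirchTorsionK
import Summits.BirchSwinnertonDyer.BirchSwinnertonDyer.Theorems.GoldfeldAllTwistsTwoConverseTwinGenusPartnerNegPrime
import Summits.BirchSwinnertonDyer.BirchSwinnertonDyer.Theorems.GoldfeldAllTwistsTwoConverseTwinGenusDescentIndex
import Summits.BirchSwinnertonDyer.BirchSwinnertonDyer.Theorems.GoldfeldAllTwistsTwoConverseTwinBirchFixedCurve
import Literature.NumberTheory.EllipticCurves.QuadraticTwistJInvariantProofs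
import Literature.NumberTheory.EllipticCurves.VariableChangePointsMap
import HarnessLib

set_option linter.dupNamespace false -- `…BirchSwinnertonDyer.BirchSwinnertonDyer…` is the cell's namespace (D-0017)
set_option autoImplicit false

/-!
# LINE B49, family F3 — the VOID lemma: over the partner field `K₂ = ℚ(√−ℓ)` the anti-invariant part of
# `X₀(49)(K₂)` (≅ `49a1^{(−ℓ)}(ℚ)`) lies in `2·X₀(49)(K₂) + X₀(49)(K₂)_tors`, granted Birch's relation `Y + Ȳ = T`

Cell `bsd-goldfeld`, seat `bsd-goldfeld-s1p-c3` (prover, gen 12); planner g28 ruling (cxxxi) TIER 0 («the VOID lemma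
`W ⊆ 2·X₀(49)(K₂) + tors`»); scoping memo `HOME/GENUS-THEOREM-A-DOUBLEPRIME-SCOPING.md` §1 (F3-c)/(F3-d). Support for item
`stmt-BirchSwinnertonDyer-19350` (twin `BSDTwoCMSplitRankOne`; serves 19140/20044 through LINE B49's family F3 =
`49a1^{(−2ℓ)}`, `ℓ ≡ 3 (mod 4)` prime, `(ℓ/7) = −1`, `d_K = −8ℓ`, genus pair `(8, −ℓ)`). Theses-free. HONEST FRAMING: BSD is
not proved by any of this; nothing open is asserted. The one printed input, Coates–Li–Tian–Zhai 2015 Thm. 1.4 at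
`(l₀, R₁, N) = (ℓ, 1, 1)` («`rank 49a1^{(−ℓ)}(ℚ) = 1`»), enters BY NAME as the binder `(h14 : thm14_rankOne_twist)` through seat
c3 gen 11's `rankOne_negPrimeTwist_of_thm14'`. BIRCH'S RELATION `Y + σY = T` for a level-`49` Heegner point `Y ∈ X₀(49)(K₂)`
(`h(−ℓ)` odd; CLTZ15 Thm. 2.2 = Gross's exact complex conjugation `x̄_K = w_N x_K^{σ}` summed over `Cl(K₂)`, with `φ(0) = T`
on the optimal curve) is NOT derived here: it is an explicit HYPOTHESIS `hY` of the theorems (the planner's order (δ) to the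
typer: ONE Gross-1991-Prop-5.3 fact; the tree's `heegnerPoint_conj_add_rootNumber_smul` gives it only up to torsion).

WHY «VOID»: on F1/F2 (`d_K = −4q, −8q`) LINE B49's Theorems A/A′ prove `y_K ∉ 2X₀(49)(·) + tors` by an `α`-descent against a
FIXED partner point of odd index. On F3 the rank-one partner `49a1^{(−ℓ)}` VARIES and its field `K₂ = ℚ(√−ℓ)` has its own
Heegner point `Y_ℓ` with `Y_ℓ + Ȳ_ℓ = T ∉ 2X₀(49)(ℚ)`; this file shows that then EVERY anti-invariant point of `X₀(49)(K₂)` —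
the whole image of `49a1^{(−ℓ)}(ℚ)` — is `2`-DIVISIBLE modulo torsion, so the mod-`2` obstruction of A/A′ vanishes identically
on F3 (memo §1 (F3-d); numerically `α(y_K) = [−2ℓ] ∈ K^{×2}` in 108/108 rows, kit j275306).

CONTENTS (on the completed-square two-torsion model `M₀^{(1)} ⊗ K`, `M₀ = [0,21,0,112,0] = cm7NFChange • X₀(49)`, the model of the
tree's `QuadraticDescent` — `incl`, `conjMap`, `twistMap`; transport to `X₀(49)(K)` itself is by `VariableChange.pointEquivBaseChange`,
Galois-equivariant by `pointEquivBaseChange_map`):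
* §1 ABSTRACT LEMMA `exists_eq_two_zsmul_add_of_trace_eq` (pure group theory): `A` abelian, `σ` an involution, `A_tors = {0, T}`,
  `T ≠ 0`, `W = {P : σP = −P} ⊆ ℤG + tors` with `σG = −G`, and some `Y` with `Y + σY = T` ⟹ `G ∈ 2A + tors`, hence
  `W ⊆ 2A + tors` (`exists_sub_two_zsmul_isOfFinAddOrder_of_trace_eq`). Proof: `Y − σY ≡ mG`; `m` even would make
  `Z = Y − (m/2)G` torsion, hence `σ`-fixed, forcing `T = 2Z = 0` resp. `T = Y + σY = 2T = 0`.
* §2 `K` imaginary quadratic with `d_K = −ℓ`, `ℓ ≠ 7` prime: `−7, 7 ∉ K²` (`not_isSquare_negPrimeField`), so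
  `M₀(K)_tors = {O, T}` (`isOfFinAddOrder_iff_M0_one_negPrime`; c301's odd-torsion theorem `eq_zero_of_odd_nsmul_eq_zero_M0_one` is
  uniform in `K`).
* §3 the anti-invariant part: `rank M₀^{(d_K)}(ℚ) = rank 49a1^{(−ℓ)}(ℚ) = 1` BY NAME (`h14`), a Mordell–Weil generator `R₀`, and
  `G = τ(R₀)`: every `P` with `σP = −P` is `≡ m • G` modulo torsion (`exists_generator_antiInvariant_M0_negPrime`).
* §4 **THE VOID LEMMA** `exists_sub_two_zsmul_isOfFinAddOrder_of_birch_negPrime`: under `h14`, for `K` with `d_K = −ℓ`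
  (`ℓ > 3` prime, `ℓ ≡ 3 (mod 4)`, `(ℓ/7) = −1`) and ANY `Y ∈ M₀^{(1)}(K)` with `Y + σY = T`: every `P ∈ M₀^{(1)}(K)` with
  `σP = −P` satisfies `P − 2Q ∈ tors` for some `Q`; §5 the same on `X₀(49)(K)` itself, `T = ι(2, −1)` (`…_cm7`).
References: J. Coates, Y. Li, Y. Tian, S. Zhai, PLMS 110 (2015) Thm 1.4, Thm 2.2 (Birch's lemma) [CoatesLiTianZhai2015];
B. Gross, in *L-functions and Arithmetic* (1991) Prop. 5.3 [GrossLMS1991]; J. H. Silverman, AEC (2009) X.2 Prop. 2.4,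
Exercise 10.16 [SilvermanAEC2009]; J. H. Silverman, J. Tate (2015) §3.5 [SilvermanTate2015].
-/

noncomputable section

open scoped Classical

open WeierstrassCurve Literature.NumberTheory.EllipticCurves Literature.NumberTheory.EllipticCurves.ModularForms
  Literature.NumberTheory.EllipticCurves.CoatesLiTianZhai2015 WeierstrassCurve.QuadraticDescent

namespace Summit.BirchSwinnertonDyer.BirchSwinnertonDyer.Theorems.GoldfeldGoodTwists

-- One decidability world for all point groups (`ℚ`, `K`): the classical one, as in `…TwinBirchTorsionK` / `…TwinGenusRankOneRat`.
attribute [local instance 2000] Classical.propDecidable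

/-! ## §1 The abstract lemma -/

section Abstract

variable {A : Type*} [AddCommGroup A]

/-- If `Z + Z` has finite order then so does `Z`. [folklore] -/
theorem isOfFinAddOrder_of_add_self {Z : A} (h : IsOfFinAddOrder (Z + Z)) : IsOfFinAddOrder Z := by
  obtain ⟨n, hn, hnZ⟩ := h.exists_nsmul_eq_zero
  refine isOfFinAddOrder_iff_nsmul_eq_zero.mpr ⟨n * 2, Nat.mul_pos hn two_pos, ?_⟩
  rw [mul_nsmul', two_nsmul, hnZ]

/-- **ABSTRACT VOID LEMMA.** Let `A` be an abelian group with an involution `σ`, whose torsion is `{0, T}` with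
`T ≠ 0`, let `G` be anti-invariant (`σG = −G`) with every anti-invariant point `≡ m • G` modulo torsion, and suppose some
`Y` has `Y + σY = T` (Birch). Then `G = 2Z + t` with `t` torsion. Proof: `Y − σY` is anti-invariant, so `≡ mG`; if
`m = 2k`, `Z := Y − kG` has `2Z ∈ {T, 2T}`, so `Z` is torsion, hence `σZ = Z`, which forces `T = 2Z = 0` resp.
`T = Y + σY = 2T = 0`; so `m = 2k + 1` and `G = 2(Y − kG) − T − t`. [cite: CoatesLiTianZhai2015, Thm. 2.2 (Birch's lemma)] -/
theorem exists_eq_two_zsmul_add_of_trace_eq (σ : A →+ A) (hσ : ∀ P, σ (σ P) = P) {T G Y : A} (hT0 : T ≠ 0)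
    (hT : IsOfFinAddOrder T) (htors : ∀ t : A, IsOfFinAddOrder t → t = 0 ∨ t = T) (hG : σ G = -G)
    (hW : ∀ P : A, σ P = -P → ∃ m : ℤ, IsOfFinAddOrder (P - m • G)) (hY : Y + σ Y = T) :
    ∃ (Z t : A), IsOfFinAddOrder t ∧ G = (2 : ℤ) • Z + t := by
  -- `2 • T = 0`, and `σ` fixes the torsion pointwise
  have h2T : T + T = 0 := by
    rcases htors _ (isOfFinAddOrder_add' hT hT) with h | h
    · exact h
    · exact absurd (by simpa using h) hT0
  have hσT : σ T = T := by
    rcases htors _ (σ.isOfFinAddOrder hT) with h | h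
    · exact absurd (by rw [← hσ T, h, map_zero]) hT0
    · exact h
  have hσt : ∀ t : A, IsOfFinAddOrder t → σ t = t := fun t ht => by
    rcases htors t ht with rfl | rfl
    · exact map_zero σ
    · exact hσT
  have h2t : ∀ t : A, IsOfFinAddOrder t → t + t = 0 := fun t ht => by
    rcases htors t ht with rfl | rfl
    · exact add_zero 0
    · exact h2T
  -- the anti-invariant point `Y − σY ≡ m • G (mod torsion)`
  obtain ⟨m, hm⟩ := hW (Y - σ Y) (by rw [map_sub, hσ]; abel)
  set t := Y - σ Y - m • G with ht
  have h2Y : (2 : ℤ) • Y = T + m • G + t := by rw [ht, ← hY]; abel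
  rcases Int.even_or_odd m with ⟨k, rfl⟩ | ⟨k, rfl⟩
  · -- `m = k + k` is impossible
    exfalso
    rw [add_zsmul] at h2Y
    set Z := Y - k • G with hZ
    have h2Z : (2 : ℤ) • Z = T + t := by rw [hZ, zsmul_sub, h2Y]; abel
    have hZfin : IsOfFinAddOrder Z := by
      refine isOfFinAddOrder_of_add_self ?_
      rw [← two_zsmul, h2Z]; exact isOfFinAddOrder_add' hT hm
    rcases htors t hm with ht0 | htT
    · -- `2Z = T`: `Z` is torsion, so `T = 2Z = 0`
      apply hT0
      rw [ht0, add_zero] at h2Z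
      rw [← h2Z, two_zsmul]
      exact h2t Z hZfin
    · -- `2Z = 2T = 0`: `Z` is torsion, hence fixed by `σ`, forcing `T = Y + σY = 2T = 0`
      have hσZ := hσt Z hZfin
      rw [hZ, map_sub, map_zsmul, hG, zsmul_neg, sub_neg_eq_add] at hσZ
      have hσY : σ Y = Y - k • G - k • G := by rw [← hσZ]; abel
      apply hT0
      calc T = Y + σ Y := hY.symm
        _ = (2 : ℤ) • Y - (k • G + k • G) := by rw [hσY, two_zsmul]; abel
        _ = T + T := by rw [h2Y, htT]; abel
        _ = 0 := h2T
  · -- `m = 2k + 1`: `G = 2 • (Y − k • G) − (T + t)`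
    refine ⟨Y - k • G, -(T + t), (isOfFinAddOrder_add' hT hm).neg, ?_⟩
    rw [add_zsmul, one_zsmul, mul_smul] at h2Y
    rw [zsmul_sub, h2Y]
    abel

/-- **Corollary: the whole anti-invariant part lies in `2A + A_tors`** (under the hypotheses of
`exists_eq_two_zsmul_add_of_trace_eq`). [cite: CoatesLiTianZhai2015, Thm. 2.2 (Birch's lemma)] -/
theorem exists_sub_two_zsmul_isOfFinAddOrder_of_trace_eq (σ : A →+ A) (hσ : ∀ P, σ (σ P) = P) {T G Y : A}
    (hT0 : T ≠ 0) (hT : IsOfFinAddOrder T) (htors : ∀ t : A, IsOfFinAddOrder t → t = 0 ∨ t = T) (hG : σ G = -G)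
    (hW : ∀ P : A, σ P = -P → ∃ m : ℤ, IsOfFinAddOrder (P - m • G)) (hY : Y + σ Y = T)
    (P : A) (hP : σ P = -P) : ∃ Q : A, IsOfFinAddOrder (P - (2 : ℤ) • Q) := by
  obtain ⟨Z, t, htfin, hGZ⟩ := exists_eq_two_zsmul_add_of_trace_eq σ hσ hT0 hT htors hG hW hY
  obtain ⟨m, hm⟩ := hW P hP
  refine ⟨m • Z, ?_⟩
  have e : P - (2 : ℤ) • (m • Z) = (P - m • G) + m • t := by
    rw [hGZ, zsmul_add, smul_comm m (2 : ℤ) Z]; abel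
  rw [e]
  exact isOfFinAddOrder_add' hm (isOfFinAddOrder_zsmul m htfin)

end Abstract

/-! ## §2 `K = ℚ(√−ℓ)`: non-squares and `M₀(K)_tors = {O, T}` -/

section PartnerField

variable {K : Type} [Field K] [NumberField K]

/-- **`−7` and `7` are not squares in `K`** for `K` imaginary quadratic with `d_K = −ℓ`, `ℓ ≠ 7` prime: a rational square in
`K` is a square in `ℚ` or `−ℓ` times one, and `−7`, `7ℓ`, `7`, `−7ℓ` are not rational squares. [cite: SilvermanTate2015, §3.5] -/
theorem not_isSquare_negPrimeField (hK : IsImaginaryQuadratic K) {l : ℕ} (hl : l.Prime) (hl7 : l ≠ 7)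
    (hdK : NumberField.discr K = -(l : ℤ)) : ¬ IsSquare (-7 : K) ∧ ¬ IsSquare (7 : K) := by
  have hdQ : ((NumberField.discr K : ℤ) : ℚ) = -(l : ℚ) := by rw [hdK]; push_cast; ring
  have red : ∀ c : ℚ, IsSquare ((c : K)) → IsSquare c ∨ IsSquare (c * -(l : ℚ)) := by
    intro c hc
    rw [← hdQ]
    refine isSquare_or_of_isSquare_algebraMap_rat hK ?_
    rwa [eq_ratCast]
  have n7l : ¬ IsSquare ((7 * l : ℕ) : ℚ) := by
    rw [Rat.isSquare_natCast_iff]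
    exact Literature.NumberTheory.GaloisRepresentations.QuadraticFamily.not_isSquare_mul_of_prime (by norm_num) hl
      (Ne.symm hl7)
  have hl0 : (0 : ℚ) < l := by exact_mod_cast hl.pos
  refine ⟨fun h => ?_, fun h => ?_⟩
  · rcases red (-7) (by push_cast; exact h) with h' | h'
    · exact not_isSquare_of_neg (by norm_num) h'
    · exact n7l (by push_cast; convert h' using 1; ring)
  · rcases red 7 (by push_cast; exact h) with h' | h'
    · exact (not_isSquare_genusConstants (q := 3) (by norm_num) (by norm_num) (by norm_num)).2.1.1 h'
    · exact not_isSquare_of_neg (by nlinarith) h'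

/-- **`M₀(K)_tors = {O, T}` for `d_K = −ℓ`** on `M₀ = ⟨0, 21, 0, 112, 0⟩ over `K` (`−7 = a₂² − 4a₄` and `7 ~ a₄` are not squares
in `K`; odd torsion is trivial by c301's `eq_zero_of_odd_nsmul_eq_zero_M0`, uniform in `K`). [cite: SilvermanTate2015, §3.5]
[cite: SilvermanAEC2009, Exercise 10.16] -/
theorem isOfFinAddOrder_iff_M0_negPrime (hK : IsImaginaryQuadratic K) {l : ℕ} (hl : l.Prime) (hl7 : l ≠ 7)
    (hdK : NumberField.discr K = -(l : ℤ)) (t : (⟨0, 21, 0, 112, 0⟩ : WeierstrassCurve K).toAffine.Point) :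
    IsOfFinAddOrder t ↔ t = 0 ∨ t = (haveI := isElliptic_M0_K (K := K);
      (⟨0, 21, 0, 112, 0⟩ : WeierstrassCurve K).twoTorsionPoint) := by
  haveI := isElliptic_M0_K (K := K)
  obtain ⟨h7, h7'⟩ := not_isSquare_negPrimeField hK hl hl7 hdK
  have hD : ¬ IsSquare ((⟨0, 21, 0, 112, 0⟩ : WeierstrassCurve K).a₂ ^ 2 -
      4 * (⟨0, 21, 0, 112, 0⟩ : WeierstrassCurve K).a₄) := by
    rw [show ((⟨0, 21, 0, 112, 0⟩ : WeierstrassCurve K).a₂ ^ 2 -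
      4 * (⟨0, 21, 0, 112, 0⟩ : WeierstrassCurve K).a₄) = -7 by norm_num]
    exact h7
  have hb : ¬ IsSquare (⟨0, 21, 0, 112, 0⟩ : WeierstrassCurve K).a₄ := by
    rw [show (⟨0, 21, 0, 112, 0⟩ : WeierstrassCurve K).a₄ = 112 by rfl]
    rintro ⟨r, hr⟩
    exact h7' (isSquare_of_sq_mul (k := 4) (by norm_num) (by linear_combination hr.symm))
  constructor
  · intro ht
    obtain ⟨m, hm, h⟩ := (⟨0, 21, 0, 112, 0⟩ : WeierstrassCurve K).exists_odd_nsmul_mem_pair hD hb ht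
    have h2m : m • ((2 : ℕ) • t) = 0 := by
      rw [← mul_nsmul', mul_comm, mul_nsmul']
      rcases h with h | h
      · rw [h, nsmul_zero]
      · rw [h, two_nsmul, twoTorsionPoint_add_twoTorsionPoint]
    have h2 : (2 : ℕ) • t = 0 := eq_zero_of_odd_nsmul_eq_zero_M0 hK _ hm h2m
    exact (⟨0, 21, 0, 112, 0⟩ : WeierstrassCurve K).eq_zero_or_eq_twoTorsionPoint_of_two_nsmul_eq_zero hD t h2
  · rintro (rfl | rfl)
    · exact IsOfFinAddOrder.zero
    · exact isOfFinAddOrder_iff_nsmul_eq_zero.mpr ⟨2, two_pos, by rw [two_nsmul, twoTorsionPoint_add_twoTorsionPoint]⟩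

/-- `(0, 0)` lies on the completed-square copy `M₀^{(1)} = M₀` over `ℚ`. [folklore] -/
theorem nonsingular_M0_quadraticTwist_one_zero :
    ((⟨0, 21, 0, 112, 0⟩ : WeierstrassCurve ℚ).quadraticTwist 1).toAffine.Nonsingular 0 0 := by
  rw [M0_quadraticTwist_one]; exact Curve49A1.nonsingular_T

/-- **`M₀^{(1)}(K)_tors = {O, ι(T)}` for `d_K = −ℓ`** (transport of `isOfFinAddOrder_iff_M0_negPrime` along the identity
`M₀^{(1)} ⊗ K = M₀ ⊗ K`). [cite: SilvermanTate2015, §3.5] -/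
theorem isOfFinAddOrder_iff_M0_one_negPrime (hK : IsImaginaryQuadratic K) {l : ℕ} (hl : l.Prime) (hl7 : l ≠ 7)
    (hdK : NumberField.discr K = -(l : ℤ))
    (t : (((⟨0, 21, 0, 112, 0⟩ : WeierstrassCurve ℚ).quadraticTwist 1).baseChange K).toAffine.Point) :
    IsOfFinAddOrder t ↔ t = 0 ∨ t = incl K _ (.some 0 0 nonsingular_M0_quadraticTwist_one_zero) := by
  set e := Affine.Point.congrEquiv (M0_quadraticTwist_one_baseChange (K := K)) with he
  have hT : e (incl K _ (.some 0 0 nonsingular_M0_quadraticTwist_one_zero)) = (haveI := isElliptic_M0_K (K := K);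
      (⟨0, 21, 0, 112, 0⟩ : WeierstrassCurve K).twoTorsionPoint) := by
    rw [he]
    exact (Affine.Point.congrEquiv_some _ _).trans (point_some_congr (map_zero _) (map_zero _))
  have h1 : IsOfFinAddOrder (e t) ↔ IsOfFinAddOrder t :=
    Function.Injective.isOfFinAddOrder_iff (f := e.toAddMonoidHom) e.injective
  rw [← h1, isOfFinAddOrder_iff_M0_negPrime hK hl hl7 hdK (e t), ← hT, ← map_zero e, e.injective.eq_iff,
    e.injective.eq_iff]

end PartnerField

/-! ## §3 The anti-invariant part of `M₀^{(1)}(K)`: rank one by name (CLTZ15 Thm. 1.4), one generator `G = τ(R₀)` -/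

section AntiInvariant

variable {K : Type} [Field K] [NumberField K]

/-- **`rank M₀^{(−ℓ)}(ℚ) = 1` BY NAME** for a prime `ℓ > 3`, `ℓ ≡ 3 (mod 4)`, `(ℓ/7) = −1`: a globally minimal model `W'` of
`49a1^{(−ℓ)} = cm7^{(−ℓ)}` exists (`exists_isGloballyMinimal_smul_eq_quadraticTwist`) and has rank `1` by Coates–Li–Tian–Zhai 2015
Thm. 1.4 at `(l₀, R₁, N) = (ℓ, 1, 1)` (seat c3 gen 11's `rankOne_negPrimeTwist_of_thm14'`, binder `h14`); the rank is transported to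
`cm7^{(−ℓ)} = C • W'` and to `M₀^{(−ℓ)} = (cm7NFChange • cm7)^{(−ℓ)} = (u, −ℓr, 0, 0) • cm7^{(−ℓ)}` (`quadraticTwist_smul`,
`mordellWeilRank_variableChange_holds`). [cite: CoatesLiTianZhai2015, Thm. 1.4 (p. 360), case k = r = 0] -/
theorem mordellWeilRank_M0_quadraticTwist_negPrime (h14 : thm14_rankOne_twist) {l : ℕ} (hl : l.Prime) (h3 : 3 < l)
    (hl4 : l % 4 = 3) (hl7 : jacobiSym l 7 = -1) :
    ((⟨0, 21, 0, 112, 0⟩ : WeierstrassCurve ℚ).quadraticTwist (-(l : ℚ))).mordellWeilRank = 1 := by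
  have hd : (-(l : ℚ)) ≠ 0 := neg_ne_zero.mpr (by exact_mod_cast hl.ne_zero)
  obtain ⟨W', hE', hmin', C, hC⟩ := exists_isGloballyMinimal_smul_eq_quadraticTwist cm7 hd
  have h1 : W'.mordellWeilRank = 1 := (rankOne_negPrimeTwist_of_thm14' h14 hl h3 hl4 hl7 W' ⟨C, hC⟩).2.1
  have h2 : (cm7.quadraticTwist (-(l : ℚ))).mordellWeilRank = 1 := by
    have h := mordellWeilRank_variableChange_holds W' C
    unfold mordellWeilRank_variableChange at h
    rw [← hC, h, h1]
  have h := mordellWeilRank_variableChange_holds (cm7.quadraticTwist (-(l : ℚ)))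
    (⟨(cm7NFChange ℚ).u, (-(l : ℚ)) * (cm7NFChange ℚ).r, 0, 0⟩ : VariableChange ℚ)
  unfold mordellWeilRank_variableChange at h
  rw [← cm7NFChange_smul_rat, quadraticTwist_smul, h, h2]

/-- **The anti-invariant part of `M₀^{(1)}(K)` is cyclic modulo torsion**, `K = ℚ(√d_K)` with `d_K = −ℓ` as above, `σ` the
conjugation of `K/ℚ` (`σδ = −δ`, `δ² = d_K`): with `R₀` a Mordell–Weil generator of `M₀^{(d_K)}(ℚ)` (rank `1`, by name) and
`G = τ(R₀)` its image under the twisting map, `σG = −G` and every `P` with `σP = −P` — which is `τ(R)` for some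
`R ∈ M₀^{(d_K)}(ℚ)` (Silverman X.2 Prop. 2.4 / Exercise 10.16) — satisfies `P − m • G ∈ tors` for some `m ∈ ℤ`.
[cite: CoatesLiTianZhai2015, Thm. 1.4 (p. 360), case k = r = 0] [cite: SilvermanAEC2009, X.2 Prop. 2.4 and Exercise 10.16] -/
theorem exists_generator_antiInvariant_M0_negPrime (h14 : thm14_rankOne_twist) (hK : IsImaginaryQuadratic K) {l : ℕ}
    (hl : l.Prime) (h3 : 3 < l) (hl4 : l % 4 = 3) (hl7 : jacobiSym l 7 = -1) (hdK : NumberField.discr K = -(l : ℤ))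
    {δ : K} (hθ : δ ∉ Set.range (algebraMap ℚ K)) (hδ : δ ^ 2 = algebraMap ℚ K (NumberField.discr K : ℚ)) :
    ∃ G : (((⟨0, 21, 0, 112, 0⟩ : WeierstrassCurve ℚ).quadraticTwist 1).baseChange K).toAffine.Point,
      conjMap _ (Literature.NumberTheory.QuadraticFields.Quadratic.conj hK.1 hθ hδ) G = -G ∧
      ∀ P, conjMap _ (Literature.NumberTheory.QuadraticFields.Quadratic.conj hK.1 hθ hδ) P = -P →
        ∃ m : ℤ, IsOfFinAddOrder (P - m • G) := by
  have hdQ : ((NumberField.discr K : ℤ) : ℚ) = -(l : ℚ) := by rw [hdK]; push_cast; ring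
  have hd0 : ((NumberField.discr K : ℤ) : ℚ) ≠ 0 := by exact_mod_cast NumberField.discr_ne_zero K
  haveI := Curve49A1.isElliptic
  haveI := (⟨0, 21, 0, 112, 0⟩ : WeierstrassCurve ℚ).isElliptic_quadraticTwist hd0
  have hrank : ((⟨0, 21, 0, 112, 0⟩ : WeierstrassCurve ℚ).quadraticTwist (NumberField.discr K : ℚ)).mordellWeilRank = 1 := by
    rw [hdQ]; exact mordellWeilRank_M0_quadraticTwist_negPrime h14 hl h3 hl4 hl7
  obtain ⟨B, hB⟩ := exists_isMordellWeilBasis_fin_one _ hrank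
  refine ⟨twistMap _ hθ hδ (B 0), conjMap_twistMap _ hθ hδ
    (Literature.NumberTheory.QuadraticFields.Quadratic.conj_gen hK.1 hθ hδ) (B 0), fun P hP => ?_⟩
  obtain ⟨R, hR⟩ := exists_twistMap_eq_of_conjMap_eq_neg _ hK.1 hθ hδ hP
  obtain ⟨a, ha⟩ := exists_sub_zsmul_isOfFinAddOrder_of_isMordellWeilBasis hB R
  refine ⟨a, ?_⟩
  rw [← hR, ← map_zsmul, ← map_sub]
  exact (twistMap _ hθ hδ).isOfFinAddOrder ha

end AntiInvariant

/-! ## §4 THE VOID LEMMA on `M₀^{(1)}(K)` and on `X₀(49)(K)` -/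

section Void

variable {K : Type} [Field K] [NumberField K]

/-- **THE VOID LEMMA (family F3).** Let `ℓ > 3` be a prime, `ℓ ≡ 3 (mod 4)`, `(ℓ/7) = −1`, `K` imaginary quadratic with
`d_K = −ℓ`, `σ` the conjugation of `K/ℚ` (`σδ = −δ`, `δ² = d_K`), acting on `M₀^{(1)}(K)`, `M₀ = [0,21,0,112,0] = cm7NFChange • X₀(49)`,
and `T = ι(0,0)` the rational `2`-torsion point. GRANTED Coates–Li–Tian–Zhai 2015 Thm. 1.4 by name (`h14`: `rank 49a1^{(−ℓ)}(ℚ) = 1`)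
and BIRCH'S RELATION `Y + σY = T` for SOME `Y ∈ M₀^{(1)}(K)` (hypothesis `hY`; in the application `Y` = the level-`49` Heegner
point of `K`, `h(−ℓ)` odd): **every anti-invariant point is `2`-divisible modulo torsion** — for every `P` with `σP = −P` there is `Q`
with `P − 2Q ∈ M₀^{(1)}(K)_tors = {O, T}`. In particular the image of `49a1^{(−ℓ)}(ℚ) ≅ {P : σP = −P}` is `⊆ 2·M₀(K) + {O, T}`: the
mod-`2` `α`-descent of LINE B49's Theorems A/A′ is void on F3 (memo §1 (F3-d)). [cite: CoatesLiTianZhai2015, Thm. 1.4 and Thm. 2.2]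
[cite: SilvermanAEC2009, X.2 Prop. 2.4 and Exercise 10.16] -/
theorem exists_sub_two_zsmul_isOfFinAddOrder_of_birch_negPrime (h14 : thm14_rankOne_twist) (hK : IsImaginaryQuadratic K)
    {l : ℕ} (hl : l.Prime) (h3 : 3 < l) (hl4 : l % 4 = 3) (hl7 : jacobiSym l 7 = -1)
    (hdK : NumberField.discr K = -(l : ℤ)) {δ : K} (hθ : δ ∉ Set.range (algebraMap ℚ K))
    (hδ : δ ^ 2 = algebraMap ℚ K (NumberField.discr K : ℚ))
    {Y : (((⟨0, 21, 0, 112, 0⟩ : WeierstrassCurve ℚ).quadraticTwist 1).baseChange K).toAffine.Point}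
    (hY : Y + conjMap _ (Literature.NumberTheory.QuadraticFields.Quadratic.conj hK.1 hθ hδ) Y = incl K _ (.some 0 0 nonsingular_M0_quadraticTwist_one_zero))
    (P : (((⟨0, 21, 0, 112, 0⟩ : WeierstrassCurve ℚ).quadraticTwist 1).baseChange K).toAffine.Point)
    (hP : conjMap _ (Literature.NumberTheory.QuadraticFields.Quadratic.conj hK.1 hθ hδ) P = -P) :
    ∃ Q : (((⟨0, 21, 0, 112, 0⟩ : WeierstrassCurve ℚ).quadraticTwist 1).baseChange K).toAffine.Point,
      IsOfFinAddOrder (P - (2 : ℤ) • Q) := by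
  have hl7' : l ≠ 7 := by rintro rfl; norm_num [jacobiSym.mod_left] at hl7
  obtain ⟨G, hG, hW⟩ := exists_generator_antiInvariant_M0_negPrime h14 hK hl h3 hl4 hl7 hdK hθ hδ
  have hσσ : ∀ z, Literature.NumberTheory.QuadraticFields.Quadratic.conj hK.1 hθ hδ
      (Literature.NumberTheory.QuadraticFields.Quadratic.conj hK.1 hθ hδ z) = z :=
    Literature.NumberTheory.QuadraticFields.Quadratic.conj_conj hK.1 hθ hδ
  refine exists_sub_two_zsmul_isOfFinAddOrder_of_trace_eq _ (conjMap_conjMap _ hσσ) ?_ ?_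
    (fun t ht => (isOfFinAddOrder_iff_M0_one_negPrime hK hl hl7' hdK t).mp ht) hG hW hY P hP
  · rw [Ne, ← map_zero (incl K ((⟨0, 21, 0, 112, 0⟩ : WeierstrassCurve ℚ).quadraticTwist 1)), (incl_injective _).eq_iff]
    exact Affine.Point.some_ne_zero _
  · exact (isOfFinAddOrder_iff_M0_one_negPrime hK hl hl7' hdK _).mpr (Or.inr rfl)

end Void

/-! ## §5 Transport to `X₀(49)(K)` itself (where the Heegner points live) -/

section Cm7

variable {K : Type} [Field K] [NumberField K]

/-- **THE VOID LEMMA on `X₀(49)(K)`** (transport of `exists_sub_two_zsmul_isOfFinAddOrder_of_birch_negPrime` along the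
Galois-equivariant isomorphism `X₀(49)(K) ≃+ M₀^{(1)}(K)` of the rational change of variables `cm7NFChange`, `(x, y) ↦ (4(x − 2), 8y + 4x)`,
`VariableChange.pointEquivBaseChange` + `pointEquivBaseChange_map`, which sends `T = ι(2, −1)` to `ι(0, 0)`): `ℓ > 3` prime,
`ℓ ≡ 3 (mod 4)`, `(ℓ/7) = −1`, `K` imaginary quadratic with `d_K = −ℓ`, `σ` its conjugation acting on `X₀(49)(K)`; granted CLTZ15
Thm. 1.4 by name (`h14`) and Birch's relation `Y + σY = ι(2, −1)` for some `Y ∈ X₀(49)(K)` (the Heegner point): every `P ∈ X₀(49)(K)`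
with `σP = −P` is `2Q + (torsion)` for some `Q ∈ X₀(49)(K)`.
[cite: CoatesLiTianZhai2015, Thm. 1.4 and Thm. 2.2] [cite: SilvermanAEC2009, III.1 Table 3.1, X.2 Prop. 2.4 and Exercise 10.16] -/
theorem exists_sub_two_zsmul_isOfFinAddOrder_of_birch_negPrime_cm7 (h14 : thm14_rankOne_twist)
    (hK : IsImaginaryQuadratic K) {l : ℕ} (hl : l.Prime) (h3 : 3 < l) (hl4 : l % 4 = 3) (hl7 : jacobiSym l 7 = -1)
    (hdK : NumberField.discr K = -(l : ℤ)) {δ : K} (hθ : δ ∉ Set.range (algebraMap ℚ K))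
    (hδ : δ ^ 2 = algebraMap ℚ K (NumberField.discr K : ℚ)) {Y : (cm7.baseChange K).toAffine.Point}
    (hY : Y + conjMap cm7 (Literature.NumberTheory.QuadraticFields.Quadratic.conj hK.1 hθ hδ) Y =
      incl K cm7 (.some 2 (-1) nonsingular_cm7_two_neg_one))
    (P : (cm7.baseChange K).toAffine.Point)
    (hP : conjMap cm7 (Literature.NumberTheory.QuadraticFields.Quadratic.conj hK.1 hθ hδ) P = -P) :
    ∃ Q : (cm7.baseChange K).toAffine.Point, IsOfFinAddOrder (P - (2 : ℤ) • Q) := by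
  have e0 : cm7NFChange ℚ • cm7 = (⟨0, 21, 0, 112, 0⟩ : WeierstrassCurve ℚ).quadraticTwist 1 :=
    cm7NFChange_smul_rat.trans M0_quadraticTwist_one.symm
  -- the Galois-equivariant isomorphism `X₀(49)(K) ≃+ M₀^{(1)}(K)`
  set Φ : (cm7.baseChange K).toAffine.Point ≃+
      (((⟨0, 21, 0, 112, 0⟩ : WeierstrassCurve ℚ).quadraticTwist 1).baseChange K).toAffine.Point :=
    (VariableChange.pointEquivBaseChange cm7 (cm7NFChange ℚ) K).trans
      (Affine.Point.congrEquiv (congrArg (fun X : WeierstrassCurve ℚ => X.baseChange K) e0)) with hΦ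
  set σ := Literature.NumberTheory.QuadraticFields.Quadratic.conj hK.1 hθ hδ with hσ
  have hmap : ∀ R : (cm7.baseChange K).toAffine.Point, Φ (Affine.Point.map σ R) = Affine.Point.map σ (Φ R) := fun R => by
    rw [hΦ, AddEquiv.trans_apply, AddEquiv.trans_apply, ← VariableChange.pointEquivBaseChange_map,
      map_congrEquiv_baseChange e0]
  -- `Φ (ι(2, −1)) = ι(0, 0)`
  have hT : Φ (incl K cm7 (.some 2 (-1) nonsingular_cm7_two_neg_one)) =
      incl K _ (.some 0 0 nonsingular_M0_quadraticTwist_one_zero) := by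
    rw [hΦ, AddEquiv.trans_apply]
    have h := VariableChange.pointEquivBaseChange_some cm7 (cm7NFChange ℚ) K
      (x := algebraMap ℚ K 2) (y := algebraMap ℚ K (-1))
      ((Affine.baseChange_nonsingular (W := cm7) (f := Algebra.ofId ℚ K) (algebraMap ℚ K).injective 2 (-1)).mpr
        nonsingular_cm7_two_neg_one)
    have hx : ((cm7NFChange ℚ).map (algebraMap ℚ K)).toX (algebraMap ℚ K 2) = algebraMap ℚ K 0 := by
      simp [VariableChange.toX_def, VariableChange.map, cm7NFChange]
    have hy : ((cm7NFChange ℚ).map (algebraMap ℚ K)).toY (algebraMap ℚ K 2) (algebraMap ℚ K (-1)) =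
        algebraMap ℚ K 0 := by
      simp [VariableChange.toY_def, VariableChange.map, cm7NFChange]
    erw [h, Affine.Point.congrEquiv_some]
    exact point_some_congr hx hy
  have hY' : Φ Y + conjMap _ σ (Φ Y) = incl K _ (.some 0 0 nonsingular_M0_quadraticTwist_one_zero) := by
    rw [← hT, ← hY, map_add, hmap]
  have hP' : conjMap _ σ (Φ P) = -(Φ P) := by
    rw [conjMap, ← hmap, ← map_neg, ← hP]
  obtain ⟨Q', hQ'⟩ :=
    exists_sub_two_zsmul_isOfFinAddOrder_of_birch_negPrime h14 hK hl h3 hl4 hl7 hdK hθ hδ hY' (Φ P) hP'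
  refine ⟨Φ.symm Q', ?_⟩
  have h1 : IsOfFinAddOrder (Φ (P - (2 : ℤ) • Φ.symm Q')) ↔ IsOfFinAddOrder (P - (2 : ℤ) • Φ.symm Q') :=
    Function.Injective.isOfFinAddOrder_iff (f := Φ.toAddMonoidHom) Φ.injective
  rw [← h1, map_sub, map_zsmul, AddEquiv.apply_symm_apply]
  exact hQ'

end Cm7

end Summit.BirchSwinnertonDyer.BirchSwinnertonDyer.Theorems.GoldfeldGoodTwists

end
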